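import Mathlib
import Summits.NavierStokesRegularity.NavierStokesRegularity.Theorems.L3TimeExponentPincerDissipationAxis
import Summits.NavierStokesRegularity.NavierStokesRegularity.Theorems.L3TimeExponentPincerSmoothBranch
import HarnessLib.Audit
import HarnessLib

/-!
# The coupled clock `Ψ = Φ · δ` as a BY-NAME node of the jaw
# (route `L3TimeExponentPincer`, crux `L3CascadeJaw`, stmt-NavierStokesRegularity-19499)
Support file for the parent crux `L3CascadeJaw` (cell ns-regularity-ideate, seat nsreg-p2, ROUND-10), on top of
`…Theorems.L3TimeExponentPincerDissipationAxis` (the coupled Morrey–dissipation criterion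
`jaw_of_coupledMorreyDissip : ∫_{T₁}^{T} (Φ δ)^{q/6} < ∞ ⇒ u ∈ L^q_t L³_x`, `0 ≤ q ≤ 6`).
* `lintegral_constMul_dissipRate_rpow_lt_top` — a bounded Morrey factor: `∫_{T/2}^{T} (M δ)^s < ∞` for `0 ≤ s ≤ 1`.
* `AllBlowupsCoupledClockB` (`@[conjecture]`, OPEN) — "every frame blow-up admits a Morrey-rate majorant `Φ`
  (`MorreyRateNear u T Φ`) whose coupled clock `Ψ = Φ · δ` lies in `L^s(T₁,T)` for every `0 ≤ s < 5/6`".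
* `allBlowupsCoupledClockB_of_fullMorreyB : AllBlowupsFullMorreyB → AllBlowupsCoupledClockB` (constant
  majorant) and `l3CascadeJaw_of_allBlowupsCoupledClockB : AllBlowupsCoupledClockB → L3CascadeJaw`
  (smooth branch = the landed `jawSmoothBranch_holds`, blow-up branch = the coupled criterion at `s = q/6`):
  the by-name ladder of typed sufficient hypotheses for the crux now reads
  `NoTypeII ⇒ AllBlowupsFullMorreyB ⇒ AllBlowupsCoupledClockB ⇒ L3CascadeJaw`, and the dissipation node
  `AllBlowupsDissipationFiveFourths` implies the coupled one at memo level (elementary majorant `Φ ≲ √(e₀ δ)`).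
  Calibration (docstrings only): parabolic Type-I profile `Ψ ≍ (T-t)^{-1/2}`; a crowd of `≍ (T-t)^{-1/2}` Type-I
  bumps `Ψ ≍ (T-t)^{-1}`; the energy-conserving dyadic cascade `Ψ ≍ (T-t)^{-6/5}` — exactly the border of the node
  (`s < 5/6`), as it must be for the `q = 5` borderline object; the slice bound `(∫|u|³)² ≲ (Φ+1) e₀ δ` behind the
  criterion is saturated by energy-saturated single eddies, so the coupled clock loses nothing on one-active-scale
  templates.
WHAT THIS IS NOT: not a claim about Navier–Stokes regularity or blow-up; no item is closed; the `@[conjecture]`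
node is open and recorded as a typed hypothesis, not asserted.
-/

noncomputable section

namespace Summit.NavierStokesRegularity.NavierStokesRegularity.Theorems.L3TimeExponentPincerCoupledClock

open MeasureTheory Set Function Filter Metric Topology
open scoped ENNReal NNReal
open Literature.Analysis.FluidPDE
open Summit.NavierStokesRegularity.NavierStokesRegularity.Theorems.L3TimeExponentPincerJawFullMorrey
open Summit.NavierStokesRegularity.NavierStokesRegularity.Theorems.L3TimeExponentPincerJawMorreyRate
open Summit.NavierStokesRegularity.NavierStokesRegularity.Theorems.L3TimeExponentPincerDissipationAxis
open Summit.NavierStokesRegularity.NavierStokesRegularity.Theses.L3TimeExponentPincer (L3CascadeJaw)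

/-- A bounded Morrey factor: `∫_{T/2}^{T} (M δ)^s < ∞` for `0 ≤ s ≤ 1` (`(Mδ)^s ≤ M^s (δ + 1)`, `∫ δ < ∞`). -/
theorem lintegral_constMul_dissipRate_rpow_lt_top {ν T : ℝ} (hT : 0 < T)
    {u : ℝ → (EuclideanSpace ℝ (Fin 3)) → (EuclideanSpace ℝ (Fin 3))} {p : ℝ → (EuclideanSpace ℝ (Fin 3)) → ℝ}
    (hcl : IsClassicalNSSolutionOn (Ico 0 T) ν 0 u p) (hLH : IsLerayHopfOn T ν 0 (u 0) u)
    (M : ℝ≥0) {s : ℝ} (hs0 : 0 ≤ s) (hs1 : s ≤ 1) :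
    ∫⁻ t in Ioo (T / 2) T, ((M : ℝ≥0∞) * dissipRate u t) ^ s < ⊤ := by
  have hdiss : ∫⁻ t in Ioo 0 T, dissipRate u t < ⊤ := dissip_lt_top hcl hLH
  have hT2 : (0 : ℝ) ≤ T / 2 := by linarith
  have hpt : ∀ t ∈ Ioo (T / 2) T, ((M : ℝ≥0∞) * dissipRate u t) ^ s ≤
      (M : ℝ≥0∞) ^ s * (dissipRate u t + 1) := by
    intro t _
    rw [ENNReal.mul_rpow_of_nonneg _ _ hs0]
    refine mul_le_mul' le_rfl ?_
    -- `x^s ≤ x + 1` for `0 ≤ s ≤ 1` (the tree's `…BoundedEnvelope.rpow_le_self_add_one`, inlined)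
    rcases le_total (dissipRate u t) 1 with hx | hx
    · exact (ENNReal.rpow_le_one hx hs0).trans (le_add_left le_rfl)
    · calc dissipRate u t ^ s ≤ dissipRate u t ^ (1 : ℝ) := ENNReal.rpow_le_rpow_of_exponent_le hx hs1
        _ = dissipRate u t := ENNReal.rpow_one _
        _ ≤ dissipRate u t + 1 := le_self_add
  have hMtop : (M : ℝ≥0∞) ^ s ≠ ⊤ := ENNReal.rpow_ne_top_of_nonneg hs0 ENNReal.coe_ne_top
  calc ∫⁻ t in Ioo (T / 2) T, ((M : ℝ≥0∞) * dissipRate u t) ^ s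
      ≤ ∫⁻ t in Ioo (T / 2) T, (M : ℝ≥0∞) ^ s * (dissipRate u t + 1) :=
        setLIntegral_mono' measurableSet_Ioo hpt
    _ = (M : ℝ≥0∞) ^ s * ((∫⁻ t in Ioo (T / 2) T, dissipRate u t) + ∫⁻ t in Ioo (T / 2) T, (1 : ℝ≥0∞)) := by
        rw [lintegral_const_mul' _ _ hMtop, lintegral_add_right _ measurable_const]
    _ < ⊤ := by
        refine ENNReal.mul_lt_top hMtop.lt_top (ENNReal.add_lt_top.2 ⟨?_, ?_⟩)
        · exact lt_of_le_of_lt (lintegral_mono_set (Ioo_subset_Ioo_left hT2)) hdiss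
        · rw [setLIntegral_const, Real.volume_Ioo]
          exact ENNReal.mul_lt_top ENNReal.one_lt_top ENNReal.ofReal_lt_top

/-- **The coupled-clock node**: every frame blow-up admits a Morrey-rate majorant `Φ` whose coupled clock
`Ψ = Φ · δ` (worst-ball scaled energy × dissipation rate) is in `L^s(T₁,T)` for every `0 ≤ s < 5/6`.  OPEN; a typed
hypothesis.  Implied by `AllBlowupsFullMorreyB` (`allBlowupsCoupledClockB_of_fullMorreyB`, hence by `NoTypeII`)
and — at memo level — by `AllBlowupsDissipationFiveFourths` through the elementary majorant `Φ ≲ √(e₀ δ)`; the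
energy-conserving dyadic cascade sits exactly at its border (`Ψ ≍ (T-t)^{-6/5}`). -/
@[conjecture] def AllBlowupsCoupledClockB : Prop :=
  ∀ (ν T : ℝ), 0 < ν → 0 < T →
    ∀ (u : ℝ → (EuclideanSpace ℝ (Fin 3)) → (EuclideanSpace ℝ (Fin 3))) (p : ℝ → (EuclideanSpace ℝ (Fin 3)) → ℝ),
    IsClassicalNSSolutionOn (Ico 0 T) ν 0 u p → IsLerayHopfOn T ν 0 (u 0) u →
    HasRapidSpatialDecay (u 0) → ¬ HasSmoothExtensionPast ν 0 u T →
    ∃ Φ : ℝ → ℝ≥0, MorreyRateNear u T Φ ∧ ∀ s : ℝ, 0 ≤ s → s < 5 / 6 →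
      ∃ T₁ < T, ∫⁻ t in Ioo T₁ T, ((Φ t : ℝ≥0∞) * dissipRate u t) ^ s < ⊤

/-- `AllBlowupsFullMorreyB ⇒ AllBlowupsCoupledClockB` (constant majorant; `∫ (Mδ)^s < ∞` for `s ≤ 1`): the coupled
node is the WEAKER typed sufficient hypothesis. -/
theorem allBlowupsCoupledClockB_of_fullMorreyB (hA : AllBlowupsFullMorreyB) : AllBlowupsCoupledClockB := by
  intro ν T hν hT u p hcl hLH hdec hext
  obtain ⟨M, hrate⟩ := morreyRateNear_const_of_full (hA ν T hν hT u p hcl hLH hdec hext)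
  exact ⟨fun _ => M, hrate, fun s hs0 hs =>
    ⟨T / 2, by linarith, lintegral_constMul_dissipRate_rpow_lt_top hT hcl hLH M hs0 (by linarith)⟩⟩

/-- **The parent crux BY NAME through the coupled clock**: `AllBlowupsCoupledClockB ⇒ L3CascadeJaw`
(`stmt-NavierStokesRegularity-19499`); smooth branch = the landed `jawSmoothBranch_holds`, blow-up branch =
`jaw_of_coupledMorreyDissip` at `s = q/6 ∈ (2/3, 5/6)`. -/
theorem l3CascadeJaw_of_allBlowupsCoupledClockB (hA : AllBlowupsCoupledClockB) : L3CascadeJaw := by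
  intro q hq4 hq5 ν T hν hT u p hcl hLH hdec
  by_cases hext : HasSmoothExtensionPast ν 0 u T
  · exact Summit.NavierStokesRegularity.NavierStokesRegularity.Theorems.L3TimeExponentPincerSmoothBranch.jawSmoothBranch_holds
      q hq4 hq5 ν T hν hT u p hcl hLH hdec hext
  · obtain ⟨Φ, hrate, hΦ⟩ := hA ν T hν hT u p hcl hLH hdec hext
    exact jaw_of_coupledMorreyDissip hν hT hcl hLH hrate (by linarith) (by linarith)
      (hΦ (q / 6) (by positivity) (by linarith))

end Summit.NavierStokesRegularity.NavierStokesRegularity.Theorems.L3TimeExponentPincerCoupledClock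

end
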